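import Summits.AtomisticToContinuum.Crystallization.Theorems.FrustratedLawDichotomyStrainedPatchTailPacking

/-!
# Strained patch — THE RIM FOLD: the priced descent with a ROW RADIUS `R` (price bound and polytope rows only within host distance `R` of the centre;
# rim rows carried by a loosened slack column) — critic row 1230, lens-5 g74 JOB 1 («rim-fold», census-endorsed)
# (decomp-a2c lens-5 «finite/base range + asymptotic regime + bridge», generation 74; crux `AperiodicFrustratedLawGap`, stmt-AtomisticToContinuum-27623)

WHY.  The record of record R1″ (`…TailPacking.coreOff_of_envelope_tailCert`) is SOUND but UNINSTANTIABLE AS TYPED (critic row 1230, census ASK-73 /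
SLACK-36): its descent steps `PriceTop` / `PriceStep` (and their host formats `HostTop` / `HostStep`) bound the quadratic price at EVERY reach row — out to
the chart rim, host distance `≈ 63/10` — and the RIM rows (`R₀ ∈ [5.9, 6.31)`, whose displacement differences are controlled only by the tube, not by
the polytope) have a certified price lower bound `20.3 σ₁`; so every step table has `k (i+1) ≥ 20.3` and no terminal `SlackCert` exists.  The rows that
decide the score live at host distance `≤ R_X ≈ 4.2`; the rim rows should impose NOTHING: no price bound, and a polytope row so loose it is free.

THE FOLD (zero edits to landed declarations — it is a CHOICE of the price `Φ` and the column `X` in g71's generic descent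
`…ChargePrice.tubeFloor_of_pricedCharge_of_descent`, decided on the HOST distance of the row, no `τ`-slop):
* `foldPrice R Φ` := `Φ` at rows with `dist (z₀ (e a)) (z₀ c₀) ≤ R`, `0` beyond;  `foldCol R X Q` := `X` within `R`, `X + Q` beyond (§1);
* (RIMTOP) `RimTop 𝓘 τ Φ R Q` — on the tube the price of every reach row beyond `R` is `≤ Q(z₀)(e a)` (a per-rim-row BOX TOP: any crude finite bound;
  the census's START tables already give one, `rimTop_of_priceTop` / `hostRimTop_of_hostTop`);
* ★ `pricedCharge_fold : PricedCharge 𝓘 τ Φ X → RimTop 𝓘 τ Φ R Q → PricedCharge 𝓘 τ (foldPrice R Φ) (foldCol R X Q)` — the rim rows' remainder is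
  absorbed by the column; ★ `priceTop_fold` / `priceStep_fold` — the folded top / step follow from the INNER top `PriceTopIn … R ρ` / INNER step
  `PriceStepIn … (foldCol R X Q) κ R ρ` (price `≤ ρ` only at reach rows within `R`; the step's polytope has the LOOSENED rim rows) and `0 ≤ ρ`;
* ★★ `tubeFloor_of_foldedDescent` / `coreOff_of_foldedDescent` — the descent with a row radius: priced charge, rim top, inner top `k 0 · σ₁`, a finite
  table of inner steps on the folded polytopes, and the terminal certificate `SlackCert 𝓘 τ (k n) σ₁ hessBlk0 force0 (foldCol R X Q)` (the census LP with
  the rim rows' force constraints loosened by `Q`, i.e. effectively dropped).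
§2 types the HOST formats the census emits — `HostTopIn` (box top at maybe-reach rows within `R`), `HostStepIn` (one constrained sup per host cell:
polytope rows at the sure-reach rows with the folded column, conclusion at maybe-reach rows within `R`), `HostRimTop` (box top at maybe-reach rows beyond
`R`) — with their soundness lemmas (g73 part 2's host reading, verbatim pattern), and §3 re-proves the records in folded form:
★★★ `coreOff_of_envelope_hostFarTab_fold` (row 1230's named target), `coreOff_of_envelope_tailCert_fold` (R1″ folded), the γ-table variants, and the
cluster-level triple (`pricedCharge_fold_of_envelope_tailCert`, `priceTop_fold_of_hostTopIn`, `priceStep_fold_of_hostStepIn`) that instantiates hand-2's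
generic junction `…RecordJunctionHost.aperiodicFrustratedLawGap_of_entryTrees_of_pricedDescent` at `Φ := foldPrice R (quadPrice …)`, `X := foldCol R X Q`.
At `R ≥ 63/10 + τ` every row is inner and the unfolded records are recovered (`hostTopIn_of_hostTop`, `hostStepIn_of_hostStep`).

No `sorry`, no new axioms, zero edits to landed declarations; every proof is a case split on `dist (z₀ (e a)) (z₀ c₀) ≤ R` over the landed seams.
-/

namespace Summit.AtomisticToContinuum.Crystallization.Theorems.FrustratedLawDichotomyStrainedPatchRimFold

open scoped BigOperators Classical RealInnerProductSpace
open Summit.AtomisticToContinuum.Crystallization.Theorems.FrustratedLawDichotomyMotifLemmas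
open Summit.AtomisticToContinuum.Crystallization.Theorems.FrustratedLawDichotomyRangeCut
open Summit.AtomisticToContinuum.Crystallization.Theorems.FrustratedLawDichotomyAveragingCut
open Summit.AtomisticToContinuum.Crystallization.Theorems.FrustratedLawDichotomyStrainedPatchHomSplit
open Summit.AtomisticToContinuum.Crystallization.Theorems.FrustratedLawDichotomyStrainedPatchCleanCollar
open Summit.AtomisticToContinuum.Crystallization.Theorems.FrustratedLawDichotomyStrainedPatchPhaseCut
open Summit.AtomisticToContinuum.Crystallization.Theorems.FrustratedLawDichotomyStrainedPatchCoreTube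
open Summit.AtomisticToContinuum.Crystallization.Theorems.FrustratedLawDichotomyStrainedPatchStrainBands
open Summit.AtomisticToContinuum.Crystallization.Theorems.FrustratedLawDichotomyStrainedPatchHomIsometry
open Summit.AtomisticToContinuum.Crystallization.Theorems.FrustratedLawDichotomyStrainedPatchHomTubeIso
open Summit.AtomisticToContinuum.Crystallization.Theorems.FrustratedLawDichotomyStrainedPatchEnvelopeLaw
open Summit.AtomisticToContinuum.Crystallization.Theorems.FrustratedLawDichotomyStrainedPatchEnvelopeTaylor
open Summit.AtomisticToContinuum.Crystallization.Theorems.FrustratedLawDichotomyStrainedPatchChartFamilies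
open Summit.AtomisticToContinuum.Crystallization.Theorems.FrustratedLawDichotomyStrainedPatchChartFamiliesPinned
open Summit.AtomisticToContinuum.Crystallization.Theorems.FrustratedLawDichotomyStrainedPatchQuantSlaving
open Summit.AtomisticToContinuum.Crystallization.Theorems.FrustratedLawDichotomyStrainedPatchHostCells
open Summit.AtomisticToContinuum.Crystallization.Theorems.FrustratedLawDichotomyStrainedPatchForceCap
open Summit.AtomisticToContinuum.Crystallization.Theorems.FrustratedLawDichotomyStrainedPatchTextureFloor
open Summit.AtomisticToContinuum.Crystallization.Theorems.FrustratedLawDichotomyStrainedPatchSVCharge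
open Summit.AtomisticToContinuum.Crystallization.Theorems.FrustratedLawDichotomyStrainedPatchChargePrice
open Summit.AtomisticToContinuum.Crystallization.Theorems.FrustratedLawDichotomyStrainedPatchTaylorTop
open Summit.AtomisticToContinuum.Crystallization.Theorems.FrustratedLawDichotomyStrainedPatchTaylorCharge
open Summit.AtomisticToContinuum.Crystallization.Theorems.FrustratedLawDichotomyStrainedPatchHostStep
open Summit.AtomisticToContinuum.Crystallization.Theorems.FrustratedLawDichotomyStrainedPatchBondCalculus
open Summit.AtomisticToContinuum.Crystallization.Theorems.FrustratedLawDichotomyStrainedPatchFarSplit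
open Summit.AtomisticToContinuum.Crystallization.Theorems.FrustratedLawDichotomyStrainedPatchTailPacking

/-! ## §1. The fold of a price and of a slack column at a host row radius `R`; the rim top; the inner top and inner step; the folded descent -/

/-- **THE ROW FOLD OF A PRICE** at host radius `R`: the price itself at rows whose host image lies within `R` of the centre, `0` at the RIM rows beyond. -/
noncomputable def foldPrice (R : ℝ) (Φ : RowPrice) : RowPrice := fun M z c M₀ z₀ c₀ e a =>
  if dist (z₀ (e a)) (z₀ c₀) ≤ R then Φ M z c M₀ z₀ c₀ e a else 0

/-- **THE FOLD OF A SLACK COLUMN** at host radius `R`: `X` within `R`, `X + Q` at the rim rows (the rim rows' remainder price `Q` moves into the column). -/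
noncomputable def foldCol (R : ℝ) (X Q : SlackTab) : SlackTab := fun M₀ z₀ c₀ h =>
  if dist (z₀ h) (z₀ c₀) ≤ R then X M₀ z₀ c₀ h else X M₀ z₀ c₀ h + Q M₀ z₀ c₀ h

section FoldValues

variable {R : ℝ} {Φ : RowPrice} {X Q : SlackTab} {M : ℕ} {z : Fin M → E3} {c : Fin M} {M₀ : ℕ} {z₀ : Fin M₀ → E3} {c₀ : Fin M₀} {e : Fin M → Fin M₀}
  {a : Fin M} {h : Fin M₀}

/-- Inner rows keep their price. [formal bookkeeping] -/
theorem foldPrice_of_le (hd : dist (z₀ (e a)) (z₀ c₀) ≤ R) : foldPrice R Φ M z c M₀ z₀ c₀ e a = Φ M z c M₀ z₀ c₀ e a := by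
  simp [foldPrice, hd]

/-- Rim rows are priced `0`. [formal bookkeeping] -/
theorem foldPrice_of_lt (hd : R < dist (z₀ (e a)) (z₀ c₀)) : foldPrice R Φ M z c M₀ z₀ c₀ e a = 0 := by
  simp [foldPrice, not_le.2 hd]

/-- Inner rows keep their column. [formal bookkeeping] -/
theorem foldCol_of_le (hd : dist (z₀ h) (z₀ c₀) ≤ R) : foldCol R X Q M₀ z₀ c₀ h = X M₀ z₀ c₀ h := by
  simp [foldCol, hd]

/-- Rim rows get the column `X + Q`. [formal bookkeeping] -/
theorem foldCol_of_lt (hd : R < dist (z₀ h) (z₀ c₀)) : foldCol R X Q M₀ z₀ c₀ h = X M₀ z₀ c₀ h + Q M₀ z₀ c₀ h := by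
  simp [foldCol, not_le.2 hd]

/-- The folded column dominates the column when `Q ≥ 0`. [formal bookkeeping] -/
theorem le_foldCol (hQ : 0 ≤ Q M₀ z₀ c₀ h) : X M₀ z₀ c₀ h ≤ foldCol R X Q M₀ z₀ c₀ h := by
  by_cases hd : dist (z₀ h) (z₀ c₀) ≤ R
  · rw [foldCol_of_le hd]
  · rw [foldCol_of_lt (not_le.1 hd)]; linarith

/-- The folded price is at most the price when `Φ ≥ 0` at the row. [formal bookkeeping] -/
theorem foldPrice_le (hΦ : 0 ≤ Φ M z c M₀ z₀ c₀ e a) : foldPrice R Φ M z c M₀ z₀ c₀ e a ≤ Φ M z c M₀ z₀ c₀ e a := by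
  by_cases hd : dist (z₀ (e a)) (z₀ c₀) ≤ R
  · rw [foldPrice_of_le hd]
  · rw [foldPrice_of_lt (not_le.1 hd)]; exact hΦ

end FoldValues

/-- ★ **(RIMTOP) `RimTop 𝓘 τ Φ R Q`** [arithmetic · INSTRUMENTABLE — a per-rim-row BOX TOP, any crude finite bound] — on every admissible clean mono-phase
`𝓘`-charted tube state (the binders of `PriceTop`), the price of every reach row whose host image lies BEYOND `R` is `≤ Q(z₀)(e a)`. -/
def RimTop (𝓘 : ChartFam) (τ : ℝ) (Φ : RowPrice) (R : ℝ) (Q : SlackTab) : Prop :=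
  ∀ (M : ℕ) (z : Fin M → E3) (c : Fin M) (M₀ : ℕ) (z₀ : Fin M₀ → E3) (c₀ : Fin M₀) (e : Fin M → Fin M₀) (t : ℝ),
    Admissible M z c → CleanBall (63 / 10) z c → MonoPhaseBall (63 / 10) z c → 0 ≤ t → t ≤ constLaw τ M₀ z₀ c₀ → ChartBy 𝓘 τ t z c z₀ c₀ e →
      FineChart τ z c z₀ c₀ e → ∀ a ∈ ball (63 / 10) z c, IsReach z c a → R < dist (z₀ (e a)) (z₀ c₀) → Φ M z c M₀ z₀ c₀ e a ≤ Q M₀ z₀ c₀ (e a)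

/-- ★ **`PriceTopIn 𝓘 τ Φ R ρ`** [arithmetic · INSTRUMENTABLE — the INNER top] — the price is `≤ ρ` at every reach row WITHIN host distance `R` of the centre, on
every charted admissible tube state (`PriceTop` with the row radius). -/
def PriceTopIn (𝓘 : ChartFam) (τ : ℝ) (Φ : RowPrice) (R ρ : ℝ) : Prop :=
  ∀ (M : ℕ) (z : Fin M → E3) (c : Fin M) (M₀ : ℕ) (z₀ : Fin M₀ → E3) (c₀ : Fin M₀) (e : Fin M → Fin M₀) (t : ℝ),
    Admissible M z c → CleanBall (63 / 10) z c → MonoPhaseBall (63 / 10) z c → 0 ≤ t → t ≤ constLaw τ M₀ z₀ c₀ → ChartBy 𝓘 τ t z c z₀ c₀ e →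
      FineChart τ z c z₀ c₀ e → ∀ a ∈ ball (63 / 10) z c, IsReach z c a → dist (z₀ (e a)) (z₀ c₀) ≤ R → Φ M z c M₀ z₀ c₀ e a ≤ ρ

/-- ★ **`PriceStepIn 𝓘 τ σ Φ H F X κ R ρ`** [INSTRUMENTABLE — one structured sup per host cell, the INNER step] — on the `κ`-inflated polytope with column `X`
(at use: the FOLDED column `foldCol R X Q`, whose rim rows are loose) the price is `≤ ρ` at every reach row within host distance `R` of the centre. -/
def PriceStepIn (𝓘 : ChartFam) (τ σ : ℝ) (Φ : RowPrice) (H : HessTab) (F : ForceTab) (X : SlackTab) (κ R ρ : ℝ) : Prop :=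
  ∀ (M : ℕ) (z : Fin M → E3) (c : Fin M) (M₀ : ℕ) (z₀ : Fin M₀ → E3) (c₀ : Fin M₀) (e : Fin M → Fin M₀) (t : ℝ),
    Admissible M z c → CleanBall (63 / 10) z c → MonoPhaseBall (63 / 10) z c → 0 ≤ t → t ≤ constLaw τ M₀ z₀ c₀ → ChartBy 𝓘 τ t z c z₀ c₀ e →
      FineChart τ z c z₀ c₀ e → InForcePolytope κ σ H F X z c z₀ c₀ e →
        ∀ a ∈ ball (63 / 10) z c, IsReach z c a → dist (z₀ (e a)) (z₀ c₀) ≤ R → Φ M z c M₀ z₀ c₀ e a ≤ ρ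

/-- ★★ **`pricedCharge_fold`** — a priced charge and a rim top give the FOLDED priced charge: at inner rows nothing changes, at rim rows the remainder
`≤ Φ + X ≤ Q + X = 0 + (X + Q)`. [formal bookkeeping] -/
theorem pricedCharge_fold {𝓘 : ChartFam} {τ R : ℝ} {Φ : RowPrice} {X Q : SlackTab} (hS : PricedCharge 𝓘 τ Φ X) (hQ : RimTop 𝓘 τ Φ R Q) :
    PricedCharge 𝓘 τ (foldPrice R Φ) (foldCol R X Q) := by
  intro M z c M₀ z₀ c₀ e t hz hcl hm ht htT hch hf a ha hr
  have h₁ := hS M z c M₀ z₀ c₀ e t hz hcl hm ht htT hch hf a ha hr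
  by_cases hd : dist (z₀ (e a)) (z₀ c₀) ≤ R
  · rw [foldPrice_of_le hd, foldCol_of_le hd]
    exact h₁
  · have hd' : R < dist (z₀ (e a)) (z₀ c₀) := not_le.1 hd
    rw [foldPrice_of_lt hd', foldCol_of_lt hd']
    have h₂ := hQ M z c M₀ z₀ c₀ e t hz hcl hm ht htT hch hf a ha hr hd'
    linarith

/-- ★★ **`priceTop_fold`** — the inner top `ρ ≥ 0` gives the top of the folded price. [formal bookkeeping] -/
theorem priceTop_fold {𝓘 : ChartFam} {τ R ρ : ℝ} {Φ : RowPrice} (hρ : 0 ≤ ρ) (hT : PriceTopIn 𝓘 τ Φ R ρ) : PriceTop 𝓘 τ (foldPrice R Φ) ρ := by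
  intro M z c M₀ z₀ c₀ e t hz hcl hm ht htT hch hf a ha hr
  by_cases hd : dist (z₀ (e a)) (z₀ c₀) ≤ R
  · rw [foldPrice_of_le hd]
    exact hT M z c M₀ z₀ c₀ e t hz hcl hm ht htT hch hf a ha hr hd
  · rw [foldPrice_of_lt (not_le.1 hd)]
    exact hρ

/-- ★★ **`priceStep_fold`** — the inner step `ρ ≥ 0` on a polytope (any column; at use the folded one) gives the step of the folded price on the same
polytope. [formal bookkeeping] -/
theorem priceStep_fold {𝓘 : ChartFam} {τ σ κ R ρ : ℝ} {Φ : RowPrice} {H : HessTab} {F : ForceTab} {Y : SlackTab} (hρ : 0 ≤ ρ)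
    (hs : PriceStepIn 𝓘 τ σ Φ H F Y κ R ρ) : PriceStep 𝓘 τ σ (foldPrice R Φ) H F Y κ ρ := by
  intro M z c M₀ z₀ c₀ e t hz hcl hm ht htT hch hf hP a ha hr
  by_cases hd : dist (z₀ (e a)) (z₀ c₀) ≤ R
  · rw [foldPrice_of_le hd]
    exact hs M z c M₀ z₀ c₀ e t hz hcl hm ht htT hch hf hP a ha hr hd
  · rw [foldPrice_of_lt (not_le.1 hd)]
    exact hρ

/-- A top is an inner top at every radius. [formal bookkeeping] -/
theorem priceTopIn_of_priceTop {𝓘 : ChartFam} {τ ρ : ℝ} {Φ : RowPrice} (R : ℝ) (h : PriceTop 𝓘 τ Φ ρ) : PriceTopIn 𝓘 τ Φ R ρ :=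
  fun M z c M₀ z₀ c₀ e t hz hcl hm ht htT hch hf a ha hr _ => h M z c M₀ z₀ c₀ e t hz hcl hm ht htT hch hf a ha hr

/-- A step is an inner step at every radius (same polytope). [formal bookkeeping] -/
theorem priceStepIn_of_priceStep {𝓘 : ChartFam} {τ σ κ ρ : ℝ} {Φ : RowPrice} {H : HessTab} {F : ForceTab} {X : SlackTab} (R : ℝ)
    (h : PriceStep 𝓘 τ σ Φ H F X κ ρ) : PriceStepIn 𝓘 τ σ Φ H F X κ R ρ :=
  fun M z c M₀ z₀ c₀ e t hz hcl hm ht htT hch hf hP a ha hr _ => h M z c M₀ z₀ c₀ e t hz hcl hm ht htT hch hf hP a ha hr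

/-- A top `ρ` is a rim top with the constant column `Q ≡ ρ` (any all-rows box top serves the rim). [formal bookkeeping] -/
theorem rimTop_of_priceTop {𝓘 : ChartFam} {τ ρ : ℝ} {Φ : RowPrice} (R : ℝ) (h : PriceTop 𝓘 τ Φ ρ) : RimTop 𝓘 τ Φ R (fun _ _ _ _ => ρ) :=
  fun M z c M₀ z₀ c₀ e t hz hcl hm ht htT hch hf a ha hr _ => h M z c M₀ z₀ c₀ e t hz hcl hm ht htT hch hf a ha hr

/-- An inner top is an inner step at every `κ` (the polytope hypothesis unused). [formal bookkeeping] -/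
theorem priceStepIn_of_priceTopIn {𝓘 : ChartFam} {τ σ R ρ : ℝ} {Φ : RowPrice} {H : HessTab} {F : ForceTab} {X : SlackTab} (κ : ℝ)
    (h : PriceTopIn 𝓘 τ Φ R ρ) : PriceStepIn 𝓘 τ σ Φ H F X κ R ρ :=
  fun M z c M₀ z₀ c₀ e t hz hcl hm ht htT hch hf _ => h M z c M₀ z₀ c₀ e t hz hcl hm ht htT hch hf

/-- The inner step is MONOTONE in the target and ANTITONE in `κ` (`σ ≥ 0`). [formal bookkeeping] -/
theorem PriceStepIn.mono {𝓘 : ChartFam} {τ σ κ κ' R ρ ρ' : ℝ} {Φ : RowPrice} {H : HessTab} {F : ForceTab} {X : SlackTab} (hκ : κ' ≤ κ) (hσ : 0 ≤ σ)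
    (hρ : ρ ≤ ρ') (h : PriceStepIn 𝓘 τ σ Φ H F X κ R ρ) : PriceStepIn 𝓘 τ σ Φ H F X κ' R ρ' :=
  fun M z c M₀ z₀ c₀ e t hz hcl hm ht htT hch hf hP a ha hr hd =>
    (h M z c M₀ z₀ c₀ e t hz hcl hm ht htT hch hf (inForcePolytope_mono hκ hσ hP) a ha hr hd).trans hρ

/-- ★★★ **THE FOLDED DESCENT TO THE TUBE FLOOR** — a priced charge, a rim top `Q`, the INNER top `k 0 · σ₁`, a finite table of INNER steps
`k i ↦ k (i+1) · σ₁` on the folded polytopes (column `foldCol R X Q`: rim rows loosened by `Q`), a nonnegative table, and the terminal certificate at `k n`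
on the folded polytope give (TF).  [formal bookkeeping: g71's `tubeFloor_of_pricedCharge_of_descent` at `Φ := foldPrice R Φ`, `X := foldCol R X Q`] -/
theorem tubeFloor_of_foldedDescent {𝓘 : ChartFam} {τ R : ℝ} {Φ : RowPrice} {X Q : SlackTab} (k : ℕ → ℝ) (n : ℕ) (hτ : 0 ≤ τ) (hk : ∀ i : ℕ, 0 ≤ k i)
    (hS : PricedCharge 𝓘 τ Φ X) (hQ : RimTop 𝓘 τ Φ R Q) (h0 : PriceTopIn 𝓘 τ Φ R (k 0 * sigmaOne))
    (hs : ∀ i : ℕ, i < n → PriceStepIn 𝓘 τ sigmaOne Φ hessBlk0 force0 (foldCol R X Q) (k i) R (k (i + 1) * sigmaOne))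
    (hC : SlackCert 𝓘 τ (k n) sigmaOne hessBlk0 force0 (foldCol R X Q)) : TubeFloor 𝓘 τ :=
  tubeFloor_of_pricedCharge_of_descent k n hτ (pricedCharge_fold hS hQ) (priceTop_fold (mul_nonneg (hk 0) sigmaOne_pos.le) h0)
    (fun i hi => priceStep_fold (mul_nonneg (hk (i + 1)) sigmaOne_pos.le) (hs i hi)) hC

/-- ★★ **[CORE-FAR] FROM THE FOLDED DESCENT AT ANY DIAL SETTING `(𝓘, τ)`** (tree junction `coreOff_of_tubeFloor_of_cover_eighth`). [formal bookkeeping] -/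
theorem coreOff_of_foldedDescent {𝓘 : ChartFam} {τ R : ℝ} {Φ : RowPrice} {X Q : SlackTab} (k : ℕ → ℝ) (n : ℕ) (hτ : 0 ≤ τ) (hk : ∀ i : ℕ, 0 ≤ k i)
    (hS : PricedCharge 𝓘 τ Φ X) (hQ : RimTop 𝓘 τ Φ R Q) (h0 : PriceTopIn 𝓘 τ Φ R (k 0 * sigmaOne))
    (hs : ∀ i : ℕ, i < n → PriceStepIn 𝓘 τ sigmaOne Φ hessBlk0 force0 (foldCol R X Q) (k i) R (k (i + 1) * sigmaOne))
    (hC : SlackCert 𝓘 τ (k n) sigmaOne hessBlk0 force0 (foldCol R X Q)) (hcov : FamilyCover 𝓘 (24 / 5) (1 / 100) (1 / 8) τ) :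
    CoreOffTubeFloor (63 / 10) (63 / 10) (24 / 5) (1 / 100) 0 :=
  coreOff_of_tubeFloor_of_cover_eighth (tubeFloor_of_foldedDescent k n hτ hk hS hQ h0 hs hC) hcov

/-! ## §2. The HOST formats with a row radius (what the census emits) and their soundness -/

/-- ★ **(HTOP-in) `HostTopIn 𝓘 τ B T r R ρ`** [INSTRUMENTABLE · finite-dimensional per host — the INNER box top `k 0 · σ₁`]: on every instance, every admissible
host reading and every maybe-reach row WITHIN host distance `R` of the centre, the host quadratic price is `≤ ρ`. -/
def HostTopIn (𝓘 : ChartFam) (τ : ℝ) (B : E3 → E3 →L[ℝ] E3 →L[ℝ] E3) (T : ℝ → ℝ → ℝ) (r R ρ : ℝ) : Prop :=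
  ∀ (M₀ : ℕ) (z₀ : Fin M₀ → E3) (c₀ : Fin M₀), 𝓘 M₀ z₀ c₀ → ∀ (O : Finset (Fin M₀)) (D : Fin M₀ → E3), HostReading τ z₀ c₀ O D →
    ∀ h ∈ O, HostMaybeReach τ z₀ c₀ O h → dist (z₀ h) (z₀ c₀) ≤ R → hostQuad B T r z₀ O D h ≤ ρ

/-- ★ **(HRIM) `HostRimTop 𝓘 τ B T r R Q`** [INSTRUMENTABLE · finite-dimensional per host — the RIM box tops]: on every instance, every admissible host reading
and every maybe-reach row BEYOND host distance `R`, the host quadratic price is `≤ Q(z₀)(h)`. -/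
def HostRimTop (𝓘 : ChartFam) (τ : ℝ) (B : E3 → E3 →L[ℝ] E3 →L[ℝ] E3) (T : ℝ → ℝ → ℝ) (r R : ℝ) (Q : SlackTab) : Prop :=
  ∀ (M₀ : ℕ) (z₀ : Fin M₀ → E3) (c₀ : Fin M₀), 𝓘 M₀ z₀ c₀ → ∀ (O : Finset (Fin M₀)) (D : Fin M₀ → E3), HostReading τ z₀ c₀ O D →
    ∀ h ∈ O, HostMaybeReach τ z₀ c₀ O h → R < dist (z₀ h) (z₀ c₀) → hostQuad B T r z₀ O D h ≤ Q M₀ z₀ c₀ h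

/-- ★ **(HSTEP-in) `HostStepIn 𝓘 τ σ B T r H F X κ R ρ`** [INSTRUMENTABLE · finite-dimensional per host — the INNER descent step, ONE constrained sup per host
cell and occupancy]: on every instance, every admissible host reading whose linear rows at the SURE-reach rows are in the `κ`-inflated polytope with
column `X` (at use the folded column: rim rows loose), the host quadratic price of every MAYBE-reach row within host distance `R` is `≤ ρ`. -/
def HostStepIn (𝓘 : ChartFam) (τ σ : ℝ) (B : E3 → E3 →L[ℝ] E3 →L[ℝ] E3) (T : ℝ → ℝ → ℝ) (r : ℝ) (H : HessTab) (F : ForceTab) (X : SlackTab)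
    (κ R ρ : ℝ) : Prop :=
  ∀ (M₀ : ℕ) (z₀ : Fin M₀ → E3) (c₀ : Fin M₀), 𝓘 M₀ z₀ c₀ → ∀ (O : Finset (Fin M₀)) (D : Fin M₀ → E3), HostReading τ z₀ c₀ O D →
    (∀ h ∈ O, HostSureReach τ z₀ c₀ O h → ‖hostLin H F z₀ c₀ O D h‖ ≤ (1 + κ) * σ + X M₀ z₀ c₀ h) →
      ∀ h ∈ O, HostMaybeReach τ z₀ c₀ O h → dist (z₀ h) (z₀ c₀) ≤ R → hostQuad B T r z₀ O D h ≤ ρ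

/-- (HTOP ρ) ⟹ (HTOP-in R ρ) at every radius. [formal bookkeeping] -/
theorem hostTopIn_of_hostTop {𝓘 : ChartFam} {τ : ℝ} {B : E3 → E3 →L[ℝ] E3 →L[ℝ] E3} {T : ℝ → ℝ → ℝ} {r ρ : ℝ} (R : ℝ) (h : HostTop 𝓘 τ B T r ρ) :
    HostTopIn 𝓘 τ B T r R ρ :=
  fun M₀ z₀ c₀ hI O D hR h' hh hm _ => h M₀ z₀ c₀ hI O D hR h' hh hm

/-- (HTOP ρ) ⟹ (HRIM R (Q ≡ ρ)): an all-rows box top serves the rim. [formal bookkeeping] -/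
theorem hostRimTop_of_hostTop {𝓘 : ChartFam} {τ : ℝ} {B : E3 → E3 →L[ℝ] E3 →L[ℝ] E3} {T : ℝ → ℝ → ℝ} {r ρ : ℝ} (R : ℝ) (h : HostTop 𝓘 τ B T r ρ) :
    HostRimTop 𝓘 τ B T r R (fun _ _ _ _ => ρ) :=
  fun M₀ z₀ c₀ hI O D hR h' hh hm _ => h M₀ z₀ c₀ hI O D hR h' hh hm

/-- (HSTEP κ ρ) ⟹ (HSTEP-in κ R ρ) at every radius (same column). [formal bookkeeping] -/
theorem hostStepIn_of_hostStep {𝓘 : ChartFam} {τ σ : ℝ} {B : E3 → E3 →L[ℝ] E3 →L[ℝ] E3} {T : ℝ → ℝ → ℝ} {r : ℝ} {H : HessTab} {F : ForceTab} {X : SlackTab}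
    {κ ρ : ℝ} (R : ℝ) (h : HostStep 𝓘 τ σ B T r H F X κ ρ) : HostStepIn 𝓘 τ σ B T r H F X κ R ρ :=
  fun M₀ z₀ c₀ hI O D hR hP h' hh hm _ => h M₀ z₀ c₀ hI O D hR hP h' hh hm

/-- An inner top is an inner step at every `κ`. [formal bookkeeping] -/
theorem hostStepIn_of_hostTopIn {𝓘 : ChartFam} {τ : ℝ} {B : E3 → E3 →L[ℝ] E3 →L[ℝ] E3} {T : ℝ → ℝ → ℝ} {r R ρ : ℝ} (h : HostTopIn 𝓘 τ B T r R ρ) (σ : ℝ)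
    (H : HessTab) (F : ForceTab) (X : SlackTab) (κ : ℝ) : HostStepIn 𝓘 τ σ B T r H F X κ R ρ :=
  fun M₀ z₀ c₀ hI O D hR _ => h M₀ z₀ c₀ hI O D hR

/-- ★★ **`priceTopIn_of_hostTopIn`** — (HTOP-in R ρ) ⟹ `PriceTopIn 𝓘 τ (quadPrice B T r) R ρ`. [formal bookkeeping over g73 part 2's host reading] -/
theorem priceTopIn_of_hostTopIn {𝓘 : ChartFam} {τ : ℝ} {B : E3 → E3 →L[ℝ] E3 →L[ℝ] E3} {T : ℝ → ℝ → ℝ} {r R ρ : ℝ} (hH : HostTopIn 𝓘 τ B T r R ρ) :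
    PriceTopIn 𝓘 τ (quadPrice B T r) R ρ := by
  intro M z c M₀ z₀ c₀ e t hz hcl hm ht htT hch hf a ha hr hd
  have hinj : ∀ b b', b ∈ ball (63 / 10) z c → b' ∈ ball (63 / 10) z c → e b = e b' → b = b' := fun b b' hb hb' hE =>
    hch.2.2.2.2.1 b b' (mem_ball.1 hb) (mem_ball.1 hb') hE
  rw [quadPrice_eq_hostQuad B T r hinj ha]
  exact hH M₀ z₀ c₀ hch.1 _ _ (hostReading_of_chart hch hf) (e a) (mem_occ_of_mem ha) (hostMaybeReach_of_isReach hf ha hr) hd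

/-- ★★ **`rimTop_of_hostRimTop`** — (HRIM R Q) ⟹ `RimTop 𝓘 τ (quadPrice B T r) R Q`. [formal bookkeeping over g73 part 2's host reading] -/
theorem rimTop_of_hostRimTop {𝓘 : ChartFam} {τ : ℝ} {B : E3 → E3 →L[ℝ] E3 →L[ℝ] E3} {T : ℝ → ℝ → ℝ} {r R : ℝ} {Q : SlackTab}
    (hH : HostRimTop 𝓘 τ B T r R Q) : RimTop 𝓘 τ (quadPrice B T r) R Q := by
  intro M z c M₀ z₀ c₀ e t hz hcl hm ht htT hch hf a ha hr hd
  have hinj : ∀ b b', b ∈ ball (63 / 10) z c → b' ∈ ball (63 / 10) z c → e b = e b' → b = b' := fun b b' hb hb' hE =>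
    hch.2.2.2.2.1 b b' (mem_ball.1 hb) (mem_ball.1 hb') hE
  rw [quadPrice_eq_hostQuad B T r hinj ha]
  exact hH M₀ z₀ c₀ hch.1 _ _ (hostReading_of_chart hch hf) (e a) (mem_occ_of_mem ha) (hostMaybeReach_of_isReach hf ha hr) hd

/-- ★★★ **`priceStepIn_of_hostStepIn`** — (HSTEP-in κ R ρ) ⟹ `PriceStepIn 𝓘 τ σ (quadPrice B T r) H F X κ R ρ`: the polytope rows of the chart transfer to the
SURE-reach host rows, the conclusion transfers back from the MAYBE-reach host rows within `R`. [formal bookkeeping over g73 part 2's host reading] -/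
theorem priceStepIn_of_hostStepIn {𝓘 : ChartFam} {τ σ : ℝ} {B : E3 → E3 →L[ℝ] E3 →L[ℝ] E3} {T : ℝ → ℝ → ℝ} {r : ℝ} {H : HessTab} {F : ForceTab}
    {X : SlackTab} {κ R ρ : ℝ} (hH : HostStepIn 𝓘 τ σ B T r H F X κ R ρ) : PriceStepIn 𝓘 τ σ (quadPrice B T r) H F X κ R ρ := by
  intro M z c M₀ z₀ c₀ e t hz hcl hm ht htT hch hf hP a ha hr hd
  have hinj : ∀ b b', b ∈ ball (63 / 10) z c → b' ∈ ball (63 / 10) z c → e b = e b' → b = b' := fun b b' hb hb' hE =>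
    hch.2.2.2.2.1 b b' (mem_ball.1 hb) (mem_ball.1 hb') hE
  rw [quadPrice_eq_hostQuad B T r hinj ha]
  refine hH M₀ z₀ c₀ hch.1 _ _ (hostReading_of_chart hch hf) (fun h hh hs => ?_) (e a) (mem_occ_of_mem ha) (hostMaybeReach_of_isReach hf ha hr) hd
  obtain ⟨a', ha', rfl, hr'⟩ := isReach_of_hostSureReach hf hh hs
  rw [← linForce_eq_hostLin H F hinj a']
  exact hP a' ha' hr'

/-- ★★ THE CLUSTER-LEVEL TRIPLE, top: (HTOP-in R ρ), `ρ ≥ 0` ⟹ `PriceTop 𝓘 τ (foldPrice R (quadPrice B T r)) ρ` (input of hand-2's generic junction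
`…RecordJunctionHost.aperiodicFrustratedLawGap_of_entryTrees_of_pricedDescent`). [formal bookkeeping] -/
theorem priceTop_fold_of_hostTopIn {𝓘 : ChartFam} {τ : ℝ} {B : E3 → E3 →L[ℝ] E3 →L[ℝ] E3} {T : ℝ → ℝ → ℝ} {r R ρ : ℝ} (hρ : 0 ≤ ρ)
    (hH : HostTopIn 𝓘 τ B T r R ρ) : PriceTop 𝓘 τ (foldPrice R (quadPrice B T r)) ρ :=
  priceTop_fold hρ (priceTopIn_of_hostTopIn hH)

/-- ★★ THE CLUSTER-LEVEL TRIPLE, step: (HSTEP-in κ R ρ), `ρ ≥ 0` ⟹ `PriceStep 𝓘 τ σ (foldPrice R (quadPrice B T r)) H F X κ ρ` (same column). [formal bookkeeping] -/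
theorem priceStep_fold_of_hostStepIn {𝓘 : ChartFam} {τ σ : ℝ} {B : E3 → E3 →L[ℝ] E3 →L[ℝ] E3} {T : ℝ → ℝ → ℝ} {r : ℝ} {H : HessTab} {F : ForceTab}
    {X : SlackTab} {κ R ρ : ℝ} (hρ : 0 ≤ ρ) (hH : HostStepIn 𝓘 τ σ B T r H F X κ R ρ) : PriceStep 𝓘 τ σ (foldPrice R (quadPrice B T r)) H F X κ ρ :=
  priceStep_fold hρ (priceStepIn_of_hostStepIn hH)

/-- ★★ THE CLUSTER-LEVEL TRIPLE, charge (general bond data): (C2L) at `m = 2τ`, host separation, the far column and the rim box tops ⟹ the FOLDED priced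
charge `PricedCharge 𝓘 τ (foldPrice R (quadPrice B (cubicTail L) r)) (foldCol R X Q)`. [formal bookkeeping: g73 part 1's discharged law + `pricedCharge_fold`] -/
theorem pricedCharge_fold_of_bondHessLip {𝓘 : ChartFam} {τ s₀ r R : ℝ} {B : E3 → E3 →L[ℝ] E3 →L[ℝ] E3} {L : ℝ → ℝ} {X Q : SlackTab}
    (hC : BondHessLip B L s₀ r (2 * τ)) (hsep : HostSep 𝓘 s₀) (hX : FarColumn 𝓘 τ r X) (hQ : HostRimTop 𝓘 τ B (cubicTail L) r R Q) :
    PricedCharge 𝓘 τ (foldPrice R (quadPrice B (cubicTail L) r)) (foldCol R X Q) :=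
  pricedCharge_fold (pricedCharge_quadPrice_of_bondHessLip hC hsep hX) (rimTop_of_hostRimTop hQ)

/-- ★★ THE CLUSTER-LEVEL TRIPLE, charge (all tables closed-form or per-host): `2τ < s₀`, host separation, `r + 2τ ≤ 7`, (HFAR), (TAILCERT), a dominating
column and the rim box tops ⟹ the FOLDED priced charge with the γ-envelope tail. [formal bookkeeping: parts 3–5 + `pricedCharge_fold`] -/
theorem pricedCharge_fold_of_envelope_tailCert {𝓘 : ChartFam} {τ s₀ r R : ℝ} {X Xh Xe Q : SlackTab} (hτ : 0 ≤ τ) (hτs : 2 * τ < s₀) (hsep : HostSep 𝓘 s₀)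
    (hr7 : r + 2 * τ ≤ 7) (hH : HostFarTab 𝓘 τ r Xh) (hT : TailCert 𝓘 τ Xe)
    (hdom : ∀ (M₀ : ℕ) (z₀ : Fin M₀ → E3) (c₀ h : Fin M₀), Xh M₀ z₀ c₀ h + Xe M₀ z₀ c₀ h ≤ X M₀ z₀ c₀ h)
    (hQ : HostRimTop 𝓘 τ bondD3 (cubicTail fun s => gammaMaj (s - 2 * τ)) r R Q) :
    PricedCharge 𝓘 τ (foldPrice R (quadPrice bondD3 (cubicTail fun s => gammaMaj (s - 2 * τ)) r)) (foldCol R X Q) :=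
  pricedCharge_fold (pricedCharge_quadPrice_of_bondHessLip (bondHessLip_env hτs) hsep (farColumn_mono hdom (farColumn_of_hostFarTab hr7 hτ hH (extTail_of_tailCert hT))))
    (rimTop_of_hostRimTop hQ)

/-! ## §3. The T-leaf records in folded form -/

/-- ★★★ **THE T-LEAF RECORD WITH HOST TABLES, FOLDED** — `[CORE-FAR]` from: the cover, (C2L) at `m = 2τ`, host separation, the far column, the RIM box tops
`Q`, the INNER host top `k 0 · σ₁`, a finite table of INNER host steps on the folded polytopes, a nonnegative table, and the terminal certificate on the folded
polytope.  [formal bookkeeping: `coreOff_of_foldedDescent` + §2] -/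
theorem coreOff_of_hostTables_fold {𝓘 : ChartFam} {τ s₀ r R : ℝ} {B : E3 → E3 →L[ℝ] E3 →L[ℝ] E3} {L : ℝ → ℝ} {X Q : SlackTab} (k : ℕ → ℝ) (n : ℕ) (hτ : 0 ≤ τ)
    (hk : ∀ i : ℕ, 0 ≤ k i) (hcov : FamilyCover 𝓘 (24 / 5) (1 / 100) (1 / 8) τ) (hC : BondHessLip B L s₀ r (2 * τ)) (hsep : HostSep 𝓘 s₀)
    (hX : FarColumn 𝓘 τ r X) (hQ : HostRimTop 𝓘 τ B (cubicTail L) r R Q) (h0 : HostTopIn 𝓘 τ B (cubicTail L) r R (k 0 * sigmaOne))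
    (hs : ∀ i : ℕ, i < n → HostStepIn 𝓘 τ sigmaOne B (cubicTail L) r hessBlk0 force0 (foldCol R X Q) (k i) R (k (i + 1) * sigmaOne))
    (hcert : SlackCert 𝓘 τ (k n) sigmaOne hessBlk0 force0 (foldCol R X Q)) : CoreOffTubeFloor (63 / 10) (63 / 10) (24 / 5) (1 / 100) 0 :=
  coreOff_of_foldedDescent k n hτ hk (pricedCharge_quadPrice_of_bondHessLip hC hsep hX) (rimTop_of_hostRimTop hQ) (priceTopIn_of_hostTopIn h0)
    (fun i hi => priceStepIn_of_hostStepIn (hs i hi)) hcert hcov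

/-- ★★★ **THE T-LEAF RECORD WITH THE γ-TABLE AND THE FAR SPLIT, FOLDED.** [formal bookkeeping: `coreOff_of_hostTables_fold` + parts 3–4] -/
theorem coreOff_of_gammaTable_hostFarTab_fold {𝓘 : ChartFam} {τ s₀ r R : ℝ} {L : ℝ → ℝ} {X Xh Xe Q : SlackTab} (k : ℕ → ℝ) (n : ℕ) (hτ : 0 ≤ τ)
    (hk : ∀ i : ℕ, 0 ≤ k i) (hcov : FamilyCover 𝓘 (24 / 5) (1 / 100) (1 / 8) τ) (hτs : 2 * τ < s₀)
    (hL : ∀ s : ℝ, s₀ ≤ s → s < r → ∀ s' : ℝ, |s' - s| ≤ 2 * τ → bondGamma s' ≤ L s) (hsep : HostSep 𝓘 s₀) (hr7 : r + 2 * τ ≤ 7)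
    (hH : HostFarTab 𝓘 τ r Xh) (hE : ExtTail 𝓘 τ Xe) (hdom : ∀ (M₀ : ℕ) (z₀ : Fin M₀ → E3) (c₀ h : Fin M₀), Xh M₀ z₀ c₀ h + Xe M₀ z₀ c₀ h ≤ X M₀ z₀ c₀ h)
    (hQ : HostRimTop 𝓘 τ bondD3 (cubicTail L) r R Q) (h0 : HostTopIn 𝓘 τ bondD3 (cubicTail L) r R (k 0 * sigmaOne))
    (hs : ∀ i : ℕ, i < n → HostStepIn 𝓘 τ sigmaOne bondD3 (cubicTail L) r hessBlk0 force0 (foldCol R X Q) (k i) R (k (i + 1) * sigmaOne))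
    (hcert : SlackCert 𝓘 τ (k n) sigmaOne hessBlk0 force0 (foldCol R X Q)) : CoreOffTubeFloor (63 / 10) (63 / 10) (24 / 5) (1 / 100) 0 :=
  coreOff_of_hostTables_fold k n hτ hk hcov (bondHessLip_of_gammaTable hτs hL) hsep (farColumn_mono hdom (farColumn_of_hostFarTab hr7 hτ hH hE)) hQ h0 hs hcert

/-- ★★★ **THE T-LEAF RECORD WITH THE ENVELOPE AND THE FAR SPLIT, FOLDED** (critic row 1230's named target: `coreOff_of_envelope_hostFarTab` with the row
radius `R` threaded through (HTOP)/(HSTEP)/(SV)) — `[CORE-FAR]` from: the cover, `2τ < s₀`, host separation, `r + 2τ ≤ 7`, (HFAR), (XTAIL), a dominating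
column `X ≥ Xh + Xe`, the RIM box tops `Q`, the INNER host top and INNER host steps with the closed-form tail `cubicTail (s ↦ gammaMaj (s − 2τ))` on the
folded polytopes (column `foldCol R X Q`), a nonnegative table, and the terminal certificate on the folded polytope. [formal bookkeeping] -/
theorem coreOff_of_envelope_hostFarTab_fold {𝓘 : ChartFam} {τ s₀ r R : ℝ} {X Xh Xe Q : SlackTab} (k : ℕ → ℝ) (n : ℕ) (hτ : 0 ≤ τ) (hk : ∀ i : ℕ, 0 ≤ k i)
    (hcov : FamilyCover 𝓘 (24 / 5) (1 / 100) (1 / 8) τ) (hτs : 2 * τ < s₀) (hsep : HostSep 𝓘 s₀) (hr7 : r + 2 * τ ≤ 7)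
    (hH : HostFarTab 𝓘 τ r Xh) (hE : ExtTail 𝓘 τ Xe) (hdom : ∀ (M₀ : ℕ) (z₀ : Fin M₀ → E3) (c₀ h : Fin M₀), Xh M₀ z₀ c₀ h + Xe M₀ z₀ c₀ h ≤ X M₀ z₀ c₀ h)
    (hQ : HostRimTop 𝓘 τ bondD3 (cubicTail fun s => gammaMaj (s - 2 * τ)) r R Q)
    (h0 : HostTopIn 𝓘 τ bondD3 (cubicTail fun s => gammaMaj (s - 2 * τ)) r R (k 0 * sigmaOne))
    (hs : ∀ i : ℕ, i < n → HostStepIn 𝓘 τ sigmaOne bondD3 (cubicTail fun s => gammaMaj (s - 2 * τ)) r hessBlk0 force0 (foldCol R X Q) (k i) R (k (i + 1) * sigmaOne))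
    (hcert : SlackCert 𝓘 τ (k n) sigmaOne hessBlk0 force0 (foldCol R X Q)) : CoreOffTubeFloor (63 / 10) (63 / 10) (24 / 5) (1 / 100) 0 :=
  coreOff_of_gammaTable_hostFarTab_fold k n hτ hk hcov hτs (gammaTable_env hτs) hsep hr7 hH hE hdom hQ h0 hs hcert

/-- ★★★ **THE T-LEAF RECORD OF RECORD R1″, FOLDED: ALL TABLES CLOSED-FORM OR PER-HOST, RIM ROWS FREE** — `[CORE-FAR]` from: the cover, `2τ < s₀`, host
separation, `r + 2τ ≤ 7`, (HFAR), the per-host-row tail certificate (TAILCERT), a dominating column, the RIM box tops `Q`, the INNER host top and INNER host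
steps with the γ-envelope tail on the folded polytopes, a nonnegative table, and the terminal certificate on the folded polytope.
[formal bookkeeping: `coreOff_of_envelope_hostFarTab_fold` + part 5's `extTail_of_tailCert`] -/
theorem coreOff_of_envelope_tailCert_fold {𝓘 : ChartFam} {τ s₀ r R : ℝ} {X Xh Xe Q : SlackTab} (k : ℕ → ℝ) (n : ℕ) (hτ : 0 ≤ τ) (hk : ∀ i : ℕ, 0 ≤ k i)
    (hcov : FamilyCover 𝓘 (24 / 5) (1 / 100) (1 / 8) τ) (hτs : 2 * τ < s₀) (hsep : HostSep 𝓘 s₀) (hr7 : r + 2 * τ ≤ 7)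
    (hH : HostFarTab 𝓘 τ r Xh) (hT : TailCert 𝓘 τ Xe) (hdom : ∀ (M₀ : ℕ) (z₀ : Fin M₀ → E3) (c₀ h : Fin M₀), Xh M₀ z₀ c₀ h + Xe M₀ z₀ c₀ h ≤ X M₀ z₀ c₀ h)
    (hQ : HostRimTop 𝓘 τ bondD3 (cubicTail fun s => gammaMaj (s - 2 * τ)) r R Q)
    (h0 : HostTopIn 𝓘 τ bondD3 (cubicTail fun s => gammaMaj (s - 2 * τ)) r R (k 0 * sigmaOne))
    (hs : ∀ i : ℕ, i < n → HostStepIn 𝓘 τ sigmaOne bondD3 (cubicTail fun s => gammaMaj (s - 2 * τ)) r hessBlk0 force0 (foldCol R X Q) (k i) R (k (i + 1) * sigmaOne))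
    (hcert : SlackCert 𝓘 τ (k n) sigmaOne hessBlk0 force0 (foldCol R X Q)) : CoreOffTubeFloor (63 / 10) (63 / 10) (24 / 5) (1 / 100) 0 :=
  coreOff_of_envelope_hostFarTab_fold k n hτ hk hcov hτs hsep hr7 hH (extTail_of_tailCert hT) hdom hQ h0 hs hcert

/-- ★★★ The same record with a census γ-table `L` instead of the envelope. [formal bookkeeping] -/
theorem coreOff_of_gammaTable_tailCert_fold {𝓘 : ChartFam} {τ s₀ r R : ℝ} {L : ℝ → ℝ} {X Xh Xe Q : SlackTab} (k : ℕ → ℝ) (n : ℕ) (hτ : 0 ≤ τ)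
    (hk : ∀ i : ℕ, 0 ≤ k i) (hcov : FamilyCover 𝓘 (24 / 5) (1 / 100) (1 / 8) τ) (hτs : 2 * τ < s₀)
    (hL : ∀ s : ℝ, s₀ ≤ s → s < r → ∀ s' : ℝ, |s' - s| ≤ 2 * τ → bondGamma s' ≤ L s) (hsep : HostSep 𝓘 s₀) (hr7 : r + 2 * τ ≤ 7)
    (hH : HostFarTab 𝓘 τ r Xh) (hT : TailCert 𝓘 τ Xe) (hdom : ∀ (M₀ : ℕ) (z₀ : Fin M₀ → E3) (c₀ h : Fin M₀), Xh M₀ z₀ c₀ h + Xe M₀ z₀ c₀ h ≤ X M₀ z₀ c₀ h)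
    (hQ : HostRimTop 𝓘 τ bondD3 (cubicTail L) r R Q) (h0 : HostTopIn 𝓘 τ bondD3 (cubicTail L) r R (k 0 * sigmaOne))
    (hs : ∀ i : ℕ, i < n → HostStepIn 𝓘 τ sigmaOne bondD3 (cubicTail L) r hessBlk0 force0 (foldCol R X Q) (k i) R (k (i + 1) * sigmaOne))
    (hcert : SlackCert 𝓘 τ (k n) sigmaOne hessBlk0 force0 (foldCol R X Q)) : CoreOffTubeFloor (63 / 10) (63 / 10) (24 / 5) (1 / 100) 0 :=
  coreOff_of_gammaTable_hostFarTab_fold k n hτ hk hcov hτs hL hsep hr7 hH (extTail_of_tailCert hT) hdom hQ h0 hs hcert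

/-- ★ RECOVERY OF THE UNFOLDED RECORD: with ALL-rows host tables (HTOP)/(HSTEP) on the folded column and the START box top as the rim column, the folded record
applies at any radius `R` — the fold never asks more than R1″ did. [formal bookkeeping] -/
theorem coreOff_of_envelope_tailCert_fold_of_hostTables {𝓘 : ChartFam} {τ s₀ r ρ : ℝ} {X Xh Xe : SlackTab} (R : ℝ) (k : ℕ → ℝ) (n : ℕ) (hτ : 0 ≤ τ)
    (hk : ∀ i : ℕ, 0 ≤ k i) (hcov : FamilyCover 𝓘 (24 / 5) (1 / 100) (1 / 8) τ) (hτs : 2 * τ < s₀) (hsep : HostSep 𝓘 s₀) (hr7 : r + 2 * τ ≤ 7)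
    (hH : HostFarTab 𝓘 τ r Xh) (hT : TailCert 𝓘 τ Xe) (hdom : ∀ (M₀ : ℕ) (z₀ : Fin M₀ → E3) (c₀ h : Fin M₀), Xh M₀ z₀ c₀ h + Xe M₀ z₀ c₀ h ≤ X M₀ z₀ c₀ h)
    (hQ : HostTop 𝓘 τ bondD3 (cubicTail fun s => gammaMaj (s - 2 * τ)) r ρ)
    (h0 : HostTop 𝓘 τ bondD3 (cubicTail fun s => gammaMaj (s - 2 * τ)) r (k 0 * sigmaOne))
    (hs : ∀ i : ℕ, i < n → HostStep 𝓘 τ sigmaOne bondD3 (cubicTail fun s => gammaMaj (s - 2 * τ)) r hessBlk0 force0 (foldCol R X fun _ _ _ _ => ρ) (k i)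
      (k (i + 1) * sigmaOne))
    (hcert : SlackCert 𝓘 τ (k n) sigmaOne hessBlk0 force0 (foldCol R X fun _ _ _ _ => ρ)) : CoreOffTubeFloor (63 / 10) (63 / 10) (24 / 5) (1 / 100) 0 :=
  coreOff_of_envelope_tailCert_fold k n hτ hk hcov hτs hsep hr7 hH hT hdom (hostRimTop_of_hostTop R hQ) (hostTopIn_of_hostTop R h0)
    (fun i hi => hostStepIn_of_hostStep R (hs i hi)) hcert

/-- The record at the cell width of record `τ = 1/100`: the side conditions read `1/50 < s₀` and `r ≤ 349/50`. [formal bookkeeping] -/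
example {𝓘 : ChartFam} {s₀ r R : ℝ} {X Xh Xe Q : SlackTab} (k : ℕ → ℝ) (n : ℕ) (hk : ∀ i : ℕ, 0 ≤ k i)
    (hcov : FamilyCover 𝓘 (24 / 5) (1 / 100) (1 / 8) (1 / 100)) (hs₀ : 1 / 50 < s₀) (hsep : HostSep 𝓘 s₀) (hr : r ≤ 349 / 50)
    (hH : HostFarTab 𝓘 (1 / 100) r Xh) (hT : TailCert 𝓘 (1 / 100) Xe)
    (hdom : ∀ (M₀ : ℕ) (z₀ : Fin M₀ → E3) (c₀ h : Fin M₀), Xh M₀ z₀ c₀ h + Xe M₀ z₀ c₀ h ≤ X M₀ z₀ c₀ h)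
    (hQ : HostRimTop 𝓘 (1 / 100) bondD3 (cubicTail fun s => gammaMaj (s - 2 * (1 / 100))) r R Q)
    (h0 : HostTopIn 𝓘 (1 / 100) bondD3 (cubicTail fun s => gammaMaj (s - 2 * (1 / 100))) r R (k 0 * sigmaOne))
    (hst : ∀ i : ℕ, i < n → HostStepIn 𝓘 (1 / 100) sigmaOne bondD3 (cubicTail fun s => gammaMaj (s - 2 * (1 / 100))) r hessBlk0 force0 (foldCol R X Q) (k i) R
      (k (i + 1) * sigmaOne))
    (hcert : SlackCert 𝓘 (1 / 100) (k n) sigmaOne hessBlk0 force0 (foldCol R X Q)) : CoreOffTubeFloor (63 / 10) (63 / 10) (24 / 5) (1 / 100) 0 :=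
  coreOff_of_envelope_tailCert_fold k n (by norm_num) hk hcov (by linarith) hsep (by linarith) hH hT hdom hQ h0 hst hcert

end Summit.AtomisticToContinuum.Crystallization.Theorems.FrustratedLawDichotomyStrainedPatchRimFold
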